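import Summits.CriticalPhenomena.PercolationContinuityZ3.Theorems.Transplant.TriFilmRouteX
import HarnessLib

/-!
# Routing in the triangular films — the exceptional configurations of the second type (`a₁ = B`, `a₂ = A`, `a₃ = C`) and the assembly

builds on p205010 (kernel theorem, internal audit signed; external expert review pending) — NOT used in this file.  Lane `prim-bschramm`, seat
`prim-bschramm-p2` (gen 33; class C1b; memo `HOME/bschramm/P2-LATTICES.md` §121); helper file (`--supports stmt-CriticalPhenomena-4575 --as helper`).
With the columns `A, B, C, D', E, F, G, H` of «TriFilmRouteX» (and their mirror images): swap pairs for `E₁ = (B,h₁)`, `E₂ = (A,h₂)`, `w' = (C,h₃)`: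
* `h₁ ≠ h₂`: `L = (B,h₁)(A,h₁) · column A`, `Br = (D',h₁)(C,h₁) · column C`; swapped `L' = (B,h₁)(D',h₁) · column D' · (B,h₂)(A,h₂)`, `Br' = (A,h₁)(C,h₁) · column C`;
* `h₁ = h₂ = h`, `h'` an adjacent layer (towards `h₃` when `h₃ ≠ h`): `L = (B,h)(B,h')(A,h')(A,h)`, `Br = (D',h)(C,h) · column C`; swapped `L' = (B,h)(D',h)(C,h)(A,h)`,
  `Br' = (B,h')(C,h') · column C` when `h₃ ≠ h`, and `L' = (B,h)(D',h)(D',h')(C,h')(A,h')(A,h)`, `Br' = (B,h')(E,h')(F,h')(G,h')(H,h')(H,h)(C,h)` when `h₃ = h`.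
* **`TriFilm.exists_swap_pair_exceptional`**: all sixteen exceptional configurations, all heights, `k ≥ 2`.
[cite: DuminilCopinSidoraviciusTassion2016, §2.3 (proof of Fact 2)]
-/

noncomputable section

namespace Summit.CriticalPhenomena.PercolationContinuityZ3.Theorems.Transplant

open Literature.Probability.Percolation Literature.Probability.LatticeModels SimpleGraph
open scoped Classical

namespace TriFilm

open TriClaw

variable {k : ℕ}

section Routes

variable {RP D : Set (Site 2)} (hRP : ∀ w : Pt, tn w ≤ 3 → w.1 ≤ 0 → toSite w ∈ RP) (hD : ∀ w : Pt, tn w ≤ 3 → w.1 ≤ 0 → toSite w ∈ D)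
include hRP hD

/-- **Type 2 (`a₁ = B`, `a₂ = A`, `a₃ = C`), distinct heights `h₁ ≠ h₂`.** [cite: DuminilCopinSidoraviciusTassion2016, §2.3 (proof of Fact 2)] -/
theorem exists_swap_pair_X2_ne (m : Bool) {h₁ h₂ h₃ : ℕ} (hh₁ : h₁ ≤ k) (hh₂ : h₂ ≤ k) (hh₃ : h₃ ≤ k) (hne : h₁ ≠ h₂) :
    ∃ r₁ r₂ : (hexShadow k).RouteData RP D (vx k (toSite (XB m)) h₁) (vx k (toSite (XA m)) h₂) (vx k (toSite (XC m)) h₃), r₁.y = r₂.b ∧ r₁.b = r₂.y := by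
  obtain ⟨hAB, hAC, hBC, hCD, hDB, -, -, -, -, -⟩ := X_adj m
  have hmemA : XA m ∈ [XA m, XB m, XC m, XD m, XE m, XF m, XG m, XH m] := by simp
  have hmemB : XB m ∈ [XA m, XB m, XC m, XD m, XE m, XF m, XG m, XH m] := by simp
  have hmemC : XC m ∈ [XA m, XB m, XC m, XD m, XE m, XF m, XG m, XH m] := by simp
  have hmemD : XD m ∈ [XA m, XB m, XC m, XD m, XE m, XF m, XG m, XH m] := by simp
  have dAB : toSite (XA m) ≠ toSite (XB m) := fun h => by have := toSite_injective h; revert this; cases m <;> decide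
  have dAC : toSite (XA m) ≠ toSite (XC m) := fun h => by have := toSite_injective h; revert this; cases m <;> decide
  have dAD : toSite (XA m) ≠ toSite (XD m) := fun h => by have := toSite_injective h; revert this; cases m <;> decide
  have dBC : toSite (XB m) ≠ toSite (XC m) := fun h => by have := toSite_injective h; revert this; cases m <;> decide
  have dBD : toSite (XB m) ≠ toSite (XD m) := fun h => by have := toSite_injective h; revert this; cases m <;> decide
  have dCD : toSite (XC m) ≠ toSite (XD m) := fun h => by have := toSite_injective h; revert this; cases m <;> decide
  have hE : vx k (toSite (XB m)) h₁ ≠ vx k (toSite (XA m)) h₂ := fun h => dAB ((vx_inj hh₁ hh₂).1 h).1.symm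
  -- Route 1
  have P1 : FPath k [vx k (toSite (XB m)) h₁, vx k (toSite (XA m)) h₁] (vx k (toSite (XB m)) h₁) (vx k (toSite (XA m)) h₁) :=
    FPath.pair (adj_vx_planar hAB.symm hh₁)
  have P2 : FPath k (vseg k (toSite (XA m)) h₁ h₂) (vx k (toSite (XA m)) h₁) (vx k (toSite (XA m)) h₂) := fpath_vseg _ hh₁ hh₂
  have SL : FPath k ([vx k (toSite (XB m)) h₁, vx k (toSite (XA m)) h₁] ++ (vseg k (toSite (XA m)) h₁ h₂).tail) (vx k (toSite (XB m)) h₁)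
      (vx k (toSite (XA m)) h₂) := by
    refine P1.trans P2 fun v hv hv1 => ?_
    simp only [List.mem_cons, List.not_mem_nil, or_false] at hv1
    rcases hv1 with rfl | rfl
    · exact absurd (fst_of_mem_vseg hv) dAB.symm
    · rfl
  set L := [vx k (toSite (XB m)) h₁, vx k (toSite (XA m)) h₁] ++ (vseg k (toSite (XA m)) h₁ h₂).tail with hL
  have mL : ∀ v ∈ L, v = vx k (toSite (XB m)) h₁ ∨ v ∈ vseg k (toSite (XA m)) h₁ h₂ := by
    intro v hv
    simp only [hL, List.cons_append, List.mem_cons] at hv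
    rcases hv with rfl | rfl | hv
    · exact Or.inl rfl
    · exact Or.inr P2.head_mem
    · exact Or.inr (List.mem_of_mem_tail hv)
  have hLRP : ∀ v ∈ L, ((v : triFilm k) : Site 2 × Site 1).1 ∈ RP := by
    intro v hv
    rcases mL v hv with h | h
    · rw [h]; exact X_RP hRP m hmemB
    · rw [fst_of_mem_vseg h]; exact X_RP hRP m hmemA
  have hsplit : L = [] ++ vx k (toSite (XB m)) h₁ :: vx k (toSite (XA m)) h₁ :: (vseg k (toSite (XA m)) h₁ h₂).tail := by simp [hL]
  have Q1 : FPath k [vx k (toSite (XB m)) h₁, vx k (toSite (XD m)) h₁, vx k (toSite (XC m)) h₁] (vx k (toSite (XB m)) h₁) (vx k (toSite (XC m)) h₁) :=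
    fpath_three (adj_vx_planar hDB.symm hh₁) (adj_vx_planar hCD.symm hh₁) (fun h => dBC ((vx_inj hh₁ hh₁).1 h).1)
  have Q2 : FPath k (vseg k (toSite (XC m)) h₁ h₃) (vx k (toSite (XC m)) h₁) (vx k (toSite (XC m)) h₃) := fpath_vseg _ hh₁ hh₃
  have RC : FPath k ([vx k (toSite (XB m)) h₁, vx k (toSite (XD m)) h₁, vx k (toSite (XC m)) h₁] ++ (vseg k (toSite (XC m)) h₁ h₃).tail)
      (vx k (toSite (XB m)) h₁) (vx k (toSite (XC m)) h₃) := by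
    refine Q1.trans Q2 fun v hv hv1 => ?_
    simp only [List.mem_cons, List.not_mem_nil, or_false] at hv1
    rcases hv1 with rfl | rfl | rfl
    · exact absurd (fst_of_mem_vseg hv) dBC
    · exact absurd (fst_of_mem_vseg hv) dCD.symm
    · rfl
  set CB := [vx k (toSite (XB m)) h₁, vx k (toSite (XD m)) h₁, vx k (toSite (XC m)) h₁] ++ (vseg k (toSite (XC m)) h₁ h₃).tail with hCB
  have mCBt : ∀ v ∈ CB.tail, v = vx k (toSite (XD m)) h₁ ∨ v ∈ vseg k (toSite (XC m)) h₁ h₃ := by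
    intro v hv
    simp only [hCB, List.cons_append, List.tail_cons, List.mem_cons] at hv
    rcases hv with rfl | rfl | hv
    · exact Or.inl rfl
    · exact Or.inr Q2.head_mem
    · exact Or.inr (List.mem_of_mem_tail hv)
  have hCBeq : CB = vx k (toSite (XB m)) h₁ :: vx k (toSite (XD m)) h₁ :: (vx k (toSite (XC m)) h₁ :: (vseg k (toSite (XC m)) h₁ h₃).tail) := by
    simp [hCB]
  have r₁ : ∃ r : (hexShadow k).RouteData RP D (vx k (toSite (XB m)) h₁) (vx k (toSite (XA m)) h₂) (vx k (toSite (XC m)) h₃),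
      r.y = vx k (toSite (XA m)) h₁ ∧ r.b = vx k (toSite (XD m)) h₁ := by
    have hCBne : CB.tail ≠ [] := by simp [hCB]
    have hCBD : ∀ v ∈ CB.tail, ((v : triFilm k) : Site 2 × Site 1).1 ∈ D := by
      intro v hv
      rcases mCBt v hv with h | h
      · rw [h]; exact X_D hD m hmemD
      · rw [fst_of_mem_vseg h]; exact X_D hD m hmemC
    have hdisj : ∀ v ∈ CB.tail, v ∉ L := by
      intro v hv hvL
      rcases mCBt v hv with rfl | h
      · rcases mL _ hvL with h' | h'
        · exact dBD ((vx_inj hh₁ hh₁).1 h').1.symm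
        · exact dAD (fst_of_mem_vseg h').symm
      · have hc := fst_of_mem_vseg h
        rcases mL _ hvL with h' | h'
        · rw [h'] at hc; exact dBC hc
        · exact dAC ((fst_of_mem_vseg h').symm.trans hc)
    exact ⟨routeData_of_paths SL hE hLRP hsplit RC hCBne hCBD hdisj, rfl, routeData_of_paths_b SL hE hLRP hsplit RC hCBne hCBD hdisj hCBeq⟩
  -- Route 2
  have P1' : FPath k [vx k (toSite (XB m)) h₁, vx k (toSite (XD m)) h₁] (vx k (toSite (XB m)) h₁) (vx k (toSite (XD m)) h₁) :=
    FPath.pair (adj_vx_planar hDB.symm hh₁)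
  have P2' : FPath k (vseg k (toSite (XD m)) h₁ h₂) (vx k (toSite (XD m)) h₁) (vx k (toSite (XD m)) h₂) := fpath_vseg _ hh₁ hh₂
  have P3' : FPath k [vx k (toSite (XD m)) h₂, vx k (toSite (XB m)) h₂, vx k (toSite (XA m)) h₂] (vx k (toSite (XD m)) h₂) (vx k (toSite (XA m)) h₂) :=
    fpath_three (adj_vx_planar hDB hh₂) (adj_vx_planar hAB.symm hh₂) (fun h => dAD ((vx_inj hh₂ hh₂).1 h).1.symm)
  have S₁' : FPath k ([vx k (toSite (XB m)) h₁, vx k (toSite (XD m)) h₁] ++ (vseg k (toSite (XD m)) h₁ h₂).tail) (vx k (toSite (XB m)) h₁)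
      (vx k (toSite (XD m)) h₂) := by
    refine P1'.trans P2' fun v hv hv1 => ?_
    simp only [List.mem_cons, List.not_mem_nil, or_false] at hv1
    rcases hv1 with rfl | rfl
    · exact absurd (fst_of_mem_vseg hv) dBD
    · rfl
  set T' := [vx k (toSite (XB m)) h₁, vx k (toSite (XD m)) h₁] ++ (vseg k (toSite (XD m)) h₁ h₂).tail with hT'
  have mT' : ∀ v ∈ T', v = vx k (toSite (XB m)) h₁ ∨ v ∈ vseg k (toSite (XD m)) h₁ h₂ := by
    intro v hv
    simp only [hT', List.cons_append, List.mem_cons] at hv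
    rcases hv with rfl | rfl | hv
    · exact Or.inl rfl
    · exact Or.inr P2'.head_mem
    · exact Or.inr (List.mem_of_mem_tail hv)
  have SL' : FPath k (T' ++ [vx k (toSite (XD m)) h₂, vx k (toSite (XB m)) h₂, vx k (toSite (XA m)) h₂].tail) (vx k (toSite (XB m)) h₁)
      (vx k (toSite (XA m)) h₂) := by
    refine S₁'.trans P3' fun v hv hv1 => ?_
    simp only [List.mem_cons, List.not_mem_nil, or_false] at hv
    rcases hv with rfl | rfl | rfl
    · rfl
    · exfalso
      rcases mT' _ hv1 with h | h
      · exact hne ((vx_inj hh₂ hh₁).1 h).2.symm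
      · exact dBD (fst_of_mem_vseg h)
    · exfalso
      rcases mT' _ hv1 with h | h
      · exact dAB ((vx_inj hh₂ hh₁).1 h).1
      · exact dAD (fst_of_mem_vseg h)
  set L' := T' ++ [vx k (toSite (XD m)) h₂, vx k (toSite (XB m)) h₂, vx k (toSite (XA m)) h₂].tail with hL'
  have mL' : ∀ v ∈ L', v = vx k (toSite (XB m)) h₁ ∨ v ∈ vseg k (toSite (XD m)) h₁ h₂ ∨ v = vx k (toSite (XB m)) h₂ ∨ v = vx k (toSite (XA m)) h₂ := by
    intro v hv
    rcases List.mem_append.1 hv with hv | hv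
    · rcases mT' v hv with h | h
      · exact Or.inl h
      · exact Or.inr (Or.inl h)
    · simp only [List.tail_cons, List.mem_cons, List.not_mem_nil, or_false] at hv
      rcases hv with h | h
      · exact Or.inr (Or.inr (Or.inl h))
      · exact Or.inr (Or.inr (Or.inr h))
  have hLRP' : ∀ v ∈ L', ((v : triFilm k) : Site 2 × Site 1).1 ∈ RP := by
    intro v hv
    rcases mL' v hv with h | h | h | h
    · rw [h]; exact X_RP hRP m hmemB
    · rw [fst_of_mem_vseg h]; exact X_RP hRP m hmemD
    · rw [h]; exact X_RP hRP m hmemB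
    · rw [h]; exact X_RP hRP m hmemA
  have hsplit' : L' = [] ++ vx k (toSite (XB m)) h₁ :: vx k (toSite (XD m)) h₁ ::
      ((vseg k (toSite (XD m)) h₁ h₂).tail ++ [vx k (toSite (XB m)) h₂, vx k (toSite (XA m)) h₂]) := by simp [hL', hT']
  have Q1' : FPath k [vx k (toSite (XB m)) h₁, vx k (toSite (XA m)) h₁, vx k (toSite (XC m)) h₁] (vx k (toSite (XB m)) h₁) (vx k (toSite (XC m)) h₁) :=
    fpath_three (adj_vx_planar hAB.symm hh₁) (adj_vx_planar hAC hh₁) (fun h => dBC ((vx_inj hh₁ hh₁).1 h).1)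
  have RC' : FPath k ([vx k (toSite (XB m)) h₁, vx k (toSite (XA m)) h₁, vx k (toSite (XC m)) h₁] ++ (vseg k (toSite (XC m)) h₁ h₃).tail)
      (vx k (toSite (XB m)) h₁) (vx k (toSite (XC m)) h₃) := by
    refine Q1'.trans Q2 fun v hv hv1 => ?_
    simp only [List.mem_cons, List.not_mem_nil, or_false] at hv1
    rcases hv1 with rfl | rfl | rfl
    · exact absurd (fst_of_mem_vseg hv) dBC
    · exact absurd (fst_of_mem_vseg hv) dAC
    · rfl
  set CB' := [vx k (toSite (XB m)) h₁, vx k (toSite (XA m)) h₁, vx k (toSite (XC m)) h₁] ++ (vseg k (toSite (XC m)) h₁ h₃).tail with hCB'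
  have mCBt' : ∀ v ∈ CB'.tail, v = vx k (toSite (XA m)) h₁ ∨ v ∈ vseg k (toSite (XC m)) h₁ h₃ := by
    intro v hv
    simp only [hCB', List.cons_append, List.tail_cons, List.mem_cons] at hv
    rcases hv with rfl | rfl | hv
    · exact Or.inl rfl
    · exact Or.inr Q2.head_mem
    · exact Or.inr (List.mem_of_mem_tail hv)
  have hCBeq' : CB' = vx k (toSite (XB m)) h₁ :: vx k (toSite (XA m)) h₁ :: (vx k (toSite (XC m)) h₁ :: (vseg k (toSite (XC m)) h₁ h₃).tail) := by
    simp [hCB']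
  have r₂ : ∃ r : (hexShadow k).RouteData RP D (vx k (toSite (XB m)) h₁) (vx k (toSite (XA m)) h₂) (vx k (toSite (XC m)) h₃),
      r.y = vx k (toSite (XD m)) h₁ ∧ r.b = vx k (toSite (XA m)) h₁ := by
    have hCBne : CB'.tail ≠ [] := by simp [hCB']
    have hCBD : ∀ v ∈ CB'.tail, ((v : triFilm k) : Site 2 × Site 1).1 ∈ D := by
      intro v hv
      rcases mCBt' v hv with h | h
      · rw [h]; exact X_D hD m hmemA
      · rw [fst_of_mem_vseg h]; exact X_D hD m hmemC
    have hdisj : ∀ v ∈ CB'.tail, v ∉ L' := by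
      intro v hv hvL
      rcases mCBt' v hv with rfl | h
      · rcases mL' _ hvL with h' | h' | h' | h'
        · exact dAB ((vx_inj hh₁ hh₁).1 h').1
        · exact dAD (fst_of_mem_vseg h')
        · exact dAB ((vx_inj hh₁ hh₂).1 h').1
        · exact hne ((vx_inj hh₁ hh₂).1 h').2
      · have hc := fst_of_mem_vseg h
        rcases mL' _ hvL with h' | h' | h' | h'
        · rw [h'] at hc; exact dBC hc
        · exact dCD ((fst_of_mem_vseg h').symm.trans hc).symm
        · rw [h'] at hc; exact dBC hc
        · rw [h'] at hc; exact dAC hc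
    exact ⟨routeData_of_paths SL' hE hLRP' hsplit' RC' hCBne hCBD hdisj, rfl, routeData_of_paths_b SL' hE hLRP' hsplit' RC' hCBne hCBD hdisj hCBeq'⟩
  obtain ⟨r₁, hy₁, hb₁⟩ := r₁
  obtain ⟨r₂, hy₂, hb₂⟩ := r₂
  exact ⟨r₁, r₂, by rw [hy₁, hb₂], by rw [hb₁, hy₂]⟩

end Routes

end TriFilm

end Summit.CriticalPhenomena.PercolationContinuityZ3.Theorems.Transplant

end
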